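import Summits.RiemannHypothesis.RiemannHypothesis.Theorems.WeilFormatCWindowFamily
import Mathlib.Analysis.SpecialFunctions.SmoothTransition
import HarnessLib

/-!
# Format C: smooth CUT-OFFS of window functions — plateaus and the uniform `O(t)` increment bound

Helper file (`--supports stmt-RiemannHypothesis-0098`, lead-track anchor), RH-free, no definitions, no named
facts. Seat rh-explicit-weil-3 (gen3). Technical core of the converse of the dictionary
(`WeilFormatCWindowClosure.lean`: positivity on `C(a)` ⟹ the window form is non-negative on `K(a)`-type windows):
a window function `u` on `[−a, a]` with jumps at `±a` is approximated INSIDE `C(a)` by `η·u` with smooth plateaus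
`η = 1` on `[−(a−2ε), a−2ε]`, `η = 0` off `(−(a−ε), a−ε)`, Lipschitz constant `O(1/ε)`; the point is an increment
bound `D_t(η·u) ≤ K₁·t + K₁'·t²` with constants INDEPENDENT of `ε` (the archimedean density `~ 1/(2t)` at `0⁺`
tolerates exactly `O(t)`).

* `exists_lipschitz_smoothTransition`: `Real.smoothTransition` is Lipschitz (some constant `C`);
* `exists_smooth_plateau`: smooth plateaus `η : ℝ → [0,1]` as above with Lipschitz constant `2C/ε`
  (product of two rescaled smooth transitions);
* `weilIncrement_comp_sub` (translation invariance of `D_t`), `weilIncrement_add_le`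
  (`D_t(p+q) ≤ 2D_t(p) + 2D_t(q)`);
* `weilIncrement_le_linear_of_small_window`: a function on a window of radius `ε`, bounded by `S₀`, `L`-Lipschitz with
  `εL ≤ Λ`, has `D_t ≤ (2Λ² + 10S₀²)·t` for all `t > 0` — small `t ≤ ε` by `weilIncrement_le_window_linear`, large
  `t ≥ ε` by `weilIncrement_le_window_const`;
* **`weilIncrement_cutoff_le`**: `D_t(η·u) ≤ 2(2aS₁²t² + 2S₀²t) + 8(2Λ² + 10S₀²)t`, `Λ = aS₁ + 2CS₀`, uniformly in `ε`
  (`η·u = u − (1−η)u`, and `(1−η)u` splits into two pieces living on windows of radius `ε` at `±(a−ε)`).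
-/

set_option autoImplicit false
set_option linter.dupNamespace false  -- the mandated namespace repeats `RiemannHypothesis`

noncomputable section

open Complex Filter Set MeasureTheory
open scoped Real Topology ComplexConjugate ContDiff

namespace Summit.RiemannHypothesis.RiemannHypothesis.Theorems.WeilFormatC

open Literature.NumberTheory.LFunctions

variable {a : ℝ}

/-! ## Smooth plateaus with controlled Lipschitz constant -/

/-- `Real.smoothTransition` is Lipschitz: `|S p − S q| ≤ C|p − q|` for some `C ≥ 0` (its derivative is continuous,
and `S` is constant off `[0, 1]`). -/
theorem exists_lipschitz_smoothTransition :
    ∃ C : ℝ, 0 ≤ C ∧ ∀ p q : ℝ, |Real.smoothTransition p - Real.smoothTransition q| ≤ C * |p - q| := by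
  have hd : ContDiff ℝ 1 Real.smoothTransition := Real.smoothTransition.contDiff
  have hcont : Continuous (deriv Real.smoothTransition) := hd.continuous_deriv le_rfl
  obtain ⟨C, hC⟩ := (isCompact_Icc (a := (0 : ℝ)) (b := 1)).exists_bound_of_continuousOn hcont.continuousOn
  have hdiff : Differentiable ℝ Real.smoothTransition := hd.differentiable one_ne_zero
  refine ⟨max C (0 : ℝ), le_max_right _ _, fun p q ↦ ?_⟩
  have key : ∀ p q : ℝ, p ∈ Icc (0 : ℝ) 1 → q ∈ Icc (0 : ℝ) 1 →
      |Real.smoothTransition p - Real.smoothTransition q| ≤ max C (0 : ℝ) * |p - q| := by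
    intro p q hp hq
    have h := (convex_Icc (0 : ℝ) 1).norm_image_sub_le_of_norm_deriv_le (C := max C (0 : ℝ))
      (fun x _ ↦ hdiff.differentiableAt) (fun x hx ↦ (hC x hx).trans (le_max_left C (0 : ℝ))) hq hp
    simpa only [Real.norm_eq_abs] using h
  -- clamp the arguments to `[0, 1]` (`Set.projIcc`, which is `1`-Lipschitz)
  have hproj : ∀ p : ℝ, Real.smoothTransition p =
      Real.smoothTransition (Set.projIcc (0 : ℝ) 1 zero_le_one p : ℝ) := by
    intro p
    rcases le_or_gt p 0 with hp | hp
    · rw [Set.projIcc_of_le_left _ hp, Real.smoothTransition.zero_of_nonpos hp]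
      exact Real.smoothTransition.zero.symm
    rcases le_or_gt 1 p with hp1 | hp1
    · rw [Set.projIcc_of_right_le _ hp1, Real.smoothTransition.one_of_one_le hp1]
      exact Real.smoothTransition.one.symm
    · rw [Set.projIcc_of_mem _ ⟨hp.le, hp1.le⟩]
  rw [hproj p, hproj q]
  exact (key _ _ (Set.projIcc _ _ _ p).2 (Set.projIcc _ _ _ q).2).trans
    (mul_le_mul_of_nonneg_left (Set.abs_projIcc_sub_projIcc zero_le_one) (le_max_right _ _))

/-- **Smooth plateaus.** For `0 < ε`, `2ε ≤ a` there is a smooth `η : ℝ → [0, 1]` with `η = 1` on `[−(a−2ε), a−2ε]`,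
`η = 0` off `(−(a−ε), a−ε)`, and Lipschitz constant `2C/ε` (`C` a Lipschitz constant of `Real.smoothTransition`). -/
theorem exists_smooth_plateau {ε : ℝ} (hε : 0 < ε) {C : ℝ}
    (hC : ∀ p q : ℝ, |Real.smoothTransition p - Real.smoothTransition q| ≤ C * |p - q|) :
    ∃ η : ℝ → ℝ, ContDiff ℝ ∞ η ∧ (∀ x, 0 ≤ η x ∧ η x ≤ 1) ∧
      (∀ x, |x| ≤ a - 2 * ε → η x = 1) ∧ (∀ x, a - ε ≤ |x| → η x = 0) ∧
      ∀ x y, |η x - η y| ≤ 2 * C / ε * |x - y| := by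
  refine ⟨fun x ↦ Real.smoothTransition ((x + (a - ε)) / ε) * Real.smoothTransition (((a - ε) - x) / ε), ?_, fun x ↦ ⟨?_, ?_⟩, fun x hx ↦ ?_,
    fun x hx ↦ ?_, fun x y ↦ ?_⟩
  · exact (Real.smoothTransition.contDiff.comp ((contDiff_id.add contDiff_const).div_const ε)).mul
      (Real.smoothTransition.contDiff.comp ((contDiff_const.sub contDiff_id).div_const ε))
  · exact mul_nonneg (Real.smoothTransition.nonneg _) (Real.smoothTransition.nonneg _)
  · exact mul_le_one₀ (Real.smoothTransition.le_one _) (Real.smoothTransition.nonneg _)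
      (Real.smoothTransition.le_one _)
  · have h1 : 1 ≤ (x + (a - ε)) / ε := by
      rw [le_div_iff₀ hε]; have := (abs_le.1 ((abs_nonneg x).trans hx |> fun _ ↦ hx)).1; linarith
    have h2 : 1 ≤ ((a - ε) - x) / ε := by
      rw [le_div_iff₀ hε]; have := (abs_le.1 hx).2; linarith
    simp only [Real.smoothTransition.one_of_one_le h1, Real.smoothTransition.one_of_one_le h2, mul_one]
  · rcases le_or_gt 0 x with h0 | h0
    · rw [abs_of_nonneg h0] at hx
      have h2 : ((a - ε) - x) / ε ≤ 0 := div_nonpos_of_nonpos_of_nonneg (by linarith) hε.le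
      simp only [Real.smoothTransition.zero_of_nonpos h2, mul_zero]
    · rw [abs_of_neg h0] at hx
      have h1 : (x + (a - ε)) / ε ≤ 0 := div_nonpos_of_nonpos_of_nonneg (by linarith) hε.le
      simp only [Real.smoothTransition.zero_of_nonpos h1, zero_mul]
  · -- Lipschitz estimate for a product of two `[0,1]`-valued Lipschitz functions
    have hC0 : 0 ≤ C := by
      have h := hC 1 0
      rw [Real.smoothTransition.one, Real.smoothTransition.zero] at h
      norm_num at h; linarith
    set S := Real.smoothTransition with hS
    have hS01 : ∀ r, |S r| ≤ 1 := fun r ↦ by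
      rw [abs_of_nonneg (Real.smoothTransition.nonneg _)]; exact Real.smoothTransition.le_one _
    set p := (x + (a - ε)) / ε
    set p' := ((a - ε) - x) / ε
    set q := (y + (a - ε)) / ε
    set q' := ((a - ε) - y) / ε
    have hpq : |p - q| = |x - y| / ε := by
      rw [show p - q = (x - y) / ε by simp only [p, q]; ring, abs_div, abs_of_pos hε]
    have hpq' : |p' - q'| = |x - y| / ε := by
      rw [show p' - q' = (y - x) / ε by simp only [p', q']; ring, abs_div, abs_of_pos hε, abs_sub_comm]
    calc |S p * S p' - S q * S q'| = |S p * (S p' - S q') + (S p - S q) * S q'| := by ring_nf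
      _ ≤ |S p * (S p' - S q')| + |(S p - S q) * S q'| := abs_add_le _ _
      _ = |S p| * |S p' - S q'| + |S p - S q| * |S q'| := by rw [abs_mul, abs_mul]
      _ ≤ 1 * (C * |p' - q'|) + C * |p - q| * 1 := by
          gcongr
          · exact hS01 p
          · exact hC _ _
          · exact hC _ _
          · exact hS01 q'
      _ = 2 * C / ε * |x - y| := by rw [hpq, hpq']; ring

/-! ## Increments of functions living on a small window are `O(t)` uniformly -/

/-- Increments are translation invariant: `D_t(w(· − c)) = D_t(w)`. -/
theorem weilIncrement_comp_sub (w : ℝ → ℂ) (c t : ℝ) :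
    weilIncrement (fun x ↦ w (x - c)) t = weilIncrement w t := by
  unfold weilIncrement
  have h := integral_sub_right_eq_self (μ := volume) (fun x ↦ ‖w (x + t) - w x‖ ^ 2) c
  simp only [add_sub_right_comm] at h ⊢
  exact h

/-- Increments are subadditive up to a factor two: `D_t(p + q) ≤ 2D_t(p) + 2D_t(q)` (when the increments of
`p` and `q` are finite). -/
theorem weilIncrement_add_le {p q : ℝ → ℂ} (t : ℝ) (hp : Integrable fun x ↦ ‖p (x + t) - p x‖ ^ 2)
    (hq : Integrable fun x ↦ ‖q (x + t) - q x‖ ^ 2) :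
    weilIncrement (p + q) t ≤ 2 * weilIncrement p t + 2 * weilIncrement q t := by
  unfold weilIncrement
  rw [← integral_const_mul, ← integral_const_mul, ← integral_add (hp.const_mul 2) (hq.const_mul 2)]
  by_cases hi : Integrable fun x ↦ ‖(p + q) (x + t) - (p + q) x‖ ^ 2
  · refine integral_mono hi ((hp.const_mul 2).add (hq.const_mul 2)) fun x ↦ ?_
    simp only [Pi.add_apply]
    have e : p (x + t) + q (x + t) - (p x + q x) = (p (x + t) - p x) + (q (x + t) - q x) := by ring
    rw [e]
    have h1 : ‖(p (x + t) - p x) + (q (x + t) - q x)‖ ^ 2 ≤ (‖p (x + t) - p x‖ + ‖q (x + t) - q x‖) ^ 2 :=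
      pow_le_pow_left₀ (norm_nonneg _) (norm_add_le _ _) 2
    nlinarith [h1, sq_nonneg (‖p (x + t) - p x‖ - ‖q (x + t) - q x‖)]
  · rw [integral_undef hi]
    exact integral_nonneg fun x ↦ by positivity

/-- **A function on a window of radius `ε` centred at `c`, bounded by `S₀` and `L`-Lipschitz there with `εL ≤ Λ`,
has `D_t ≤ (2Λ² + 10S₀²)·t` for all `t > 0`** — uniformly in `ε` (small `t ≤ ε`: the Lipschitz bound
`weilIncrement_le_window_linear`; large `t ≥ ε`: the support bound `weilIncrement_le_window_const`). -/
theorem weilIncrement_le_linear_of_small_window {w : ℝ → ℂ} {c ε S₀ L Λ : ℝ} (hε : 0 < ε)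
    (hm : Measurable w) (hz : ∀ x, x ∉ Icc (c - ε) (c + ε) → w x = 0) (hb : ∀ x, ‖w x‖ ≤ S₀)
    (hl : ∀ x y, x ∈ Icc (c - ε) (c + ε) → y ∈ Icc (c - ε) (c + ε) → ‖w y - w x‖ ≤ L * |y - x|)
    (hL : 0 ≤ L) (hΛ : ε * L ≤ Λ) {t : ℝ} (ht : 0 < t) :
    weilIncrement w t ≤ (2 * Λ ^ 2 + 10 * S₀ ^ 2) * t := by
  -- translate to the centred window `[−ε, ε]`
  set v : ℝ → ℂ := fun y ↦ w (y + c) with hv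
  have hwv : weilIncrement w t = weilIncrement v t := by
    rw [← weilIncrement_comp_sub v c t]
    simp only [hv, sub_add_cancel]
  have hvm : Measurable v := hm.comp (measurable_id.add_const c)
  have hmemI : ∀ y, y ∈ Icc (-ε) ε ↔ y + c ∈ Icc (c - ε) (c + ε) := fun y ↦ by
    simp only [mem_Icc]; constructor <;> rintro ⟨h1, h2⟩ <;> constructor <;> linarith
  have hvz : ∀ y, y ∉ Icc (-ε) ε → v y = 0 := fun y hy ↦ hz _ (mt (hmemI y).2 hy)
  have hvb : ∀ y, ‖v y‖ ≤ S₀ := fun y ↦ hb _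
  have hvl : ∀ x y, x ∈ Icc (-ε) ε → y ∈ Icc (-ε) ε → ‖v y - v x‖ ≤ L * |y - x| := by
    intro x y hx hy
    have h := hl (x + c) (y + c) ((hmemI x).1 hx) ((hmemI y).1 hy)
    simpa only [hv, add_sub_add_right_eq_sub] using h
  rw [hwv]
  have hS₀ : 0 ≤ S₀ := (norm_nonneg _).trans (hb 0)
  rcases le_or_gt t ε with htε | hεt
  · have h := weilIncrement_le_window_linear hε.le hvm hvz hvb hvl ht.le
    have h1 : ε * L ^ 2 * t ≤ Λ ^ 2 := by
      calc ε * L ^ 2 * t ≤ ε * L ^ 2 * ε := by gcongr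
        _ = (ε * L) ^ 2 := by ring
        _ ≤ Λ ^ 2 := pow_le_pow_left₀ (by positivity) hΛ 2
    nlinarith [sq_nonneg S₀, h1, ht]
  · have h := weilIncrement_le_window_const hε.le hvm hvz hvb t
    nlinarith [sq_nonneg S₀, sq_nonneg Λ, h, hεt]

/-! ## The cut-off estimate -/

/-- **Increments of a smooth cut-off.** Let `u` be a window function on `[−a, a]` (`‖u‖ ≤ S₀`, `S₁`-Lipschitz on the
window) and `η : ℝ → [0,1]` a plateau (`η = 1` on `[−(a−2ε), a−2ε]`, Lipschitz constant `2C/ε`, `0 < ε`, `2ε ≤ a`).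
Then for `t > 0`: `D_t(η·u) ≤ 2·(2aS₁²t² + 2S₀²t) + 8·(2Λ² + 10S₀²)·t` with `Λ = aS₁ + 2CS₀` — uniformly in `ε`. -/
theorem weilIncrement_cutoff_le (ha : 0 < a) {u : ℝ → ℂ} {η : ℝ → ℝ} {ε S₀ S₁ C : ℝ} (hε : 0 < ε)
    (h2ε : 2 * ε ≤ a) (hum : Measurable u) (huz : ∀ x, x ∉ Icc (-a) a → u x = 0) (hS₀ : ∀ x, ‖u x‖ ≤ S₀)
    (hS₁ : ∀ x y, x ∈ Icc (-a) a → y ∈ Icc (-a) a → ‖u y - u x‖ ≤ S₁ * |y - x|) (hS₁0 : 0 ≤ S₁)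
    (hC0 : 0 ≤ C) (hηm : Measurable η) (hη01 : ∀ x, 0 ≤ η x ∧ η x ≤ 1)
    (hη1 : ∀ x, |x| ≤ a - 2 * ε → η x = 1) (hηL : ∀ x y, |η x - η y| ≤ 2 * C / ε * |x - y|)
    {t : ℝ} (ht : 0 < t) :
    weilIncrement (fun x ↦ (η x : ℂ) * u x) t ≤
      2 * (2 * a * S₁ ^ 2 * t ^ 2 + 2 * S₀ ^ 2 * t) +
        8 * ((2 * (a * S₁ + 2 * C * S₀) ^ 2 + 10 * S₀ ^ 2) * t) := by
  have hS₀0 : 0 ≤ S₀ := (norm_nonneg _).trans (hS₀ 0)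
  have hεa : ε ≤ a := by linarith
  -- the defect `w = −(1 − η)·u` and its two one-sided pieces
  set w : ℝ → ℂ := fun x ↦ -((((1 - η x : ℝ)) : ℂ) * u x) with hw
  set wp : ℝ → ℂ := fun x ↦ if 0 ≤ x then w x else 0 with hwp
  set wm : ℝ → ℂ := fun x ↦ if 0 ≤ x then 0 else w x with hwm
  have hg : (fun x ↦ (η x : ℂ) * u x) = u + w := by
    funext x; simp only [hw, Pi.add_apply]; push_cast; ring
  have hwsplit : w = wp + wm := by
    funext x; simp only [hwp, hwm, Pi.add_apply]; split_ifs <;> simp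
  have hwm_meas : Measurable w :=
    ((Complex.measurable_ofReal.comp (measurable_const.sub hηm)).mul hum).neg
  have hwpm : Measurable wp := Measurable.ite measurableSet_Ici hwm_meas measurable_const
  have hwmm : Measurable wm := Measurable.ite measurableSet_Ici measurable_const hwm_meas
  -- pointwise facts on `w`
  have hw0 : ∀ x, x ∉ Icc (-a) a → w x = 0 := fun x hx ↦ by simp only [hw, huz x hx, mul_zero, neg_zero]
  have hwb : ∀ x, ‖w x‖ ≤ S₀ := by
    intro x
    rw [hw]; dsimp only
    rw [norm_neg, norm_mul, Complex.norm_real, Real.norm_eq_abs,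
      abs_of_nonneg (by linarith [(hη01 x).2] : (0 : ℝ) ≤ 1 - η x)]
    calc (1 - η x) * ‖u x‖ ≤ 1 * S₀ := by
          gcongr
          · linarith [(hη01 x).1]
          · exact hS₀ x
      _ = S₀ := one_mul _
  have hw1 : ∀ x, |x| ≤ a - 2 * ε → w x = 0 := fun x hx ↦ by
    simp only [hw, hη1 x hx, sub_self, Complex.ofReal_zero, zero_mul, neg_zero]
  have hwlip : ∀ x y, x ∈ Icc (-a) a → y ∈ Icc (-a) a →
      ‖w y - w x‖ ≤ (S₁ + 2 * C / ε * S₀) * |y - x| := by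
    intro x y hx hy
    have e : w y - w x = ((1 - η y : ℝ) : ℂ) * (u x - u y) + ((η y - η x : ℝ) : ℂ) * u x := by
      simp only [hw]; push_cast; ring
    rw [e]
    calc ‖((1 - η y : ℝ) : ℂ) * (u x - u y) + ((η y - η x : ℝ) : ℂ) * u x‖
        ≤ ‖((1 - η y : ℝ) : ℂ) * (u x - u y)‖ + ‖((η y - η x : ℝ) : ℂ) * u x‖ := norm_add_le _ _
      _ = |1 - η y| * ‖u x - u y‖ + |η y - η x| * ‖u x‖ := by
          rw [norm_mul, norm_mul, Complex.norm_real, Complex.norm_real, Real.norm_eq_abs, Real.norm_eq_abs]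
      _ ≤ 1 * (S₁ * |y - x|) + 2 * C / ε * |y - x| * S₀ := by
          gcongr
          · rw [abs_of_nonneg (by linarith [(hη01 y).2] : (0 : ℝ) ≤ 1 - η y)]; linarith [(hη01 y).1]
          · rw [norm_sub_rev]; exact hS₁ x y hx hy
          · exact hηL y x
          · exact hS₀ x
      _ = (S₁ + 2 * C / ε * S₀) * |y - x| := by ring
  have hL0 : 0 ≤ S₁ + 2 * C / ε * S₀ := by positivity
  have hΛ : ε * (S₁ + 2 * C / ε * S₀) ≤ a * S₁ + 2 * C * S₀ := by
    rw [mul_add, show ε * (2 * C / ε * S₀) = 2 * C * S₀ by field_simp]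
    gcongr
  -- the right piece lives on `[a − 2ε, a] = [c − ε, c + ε]`, `c = a − ε`
  have hwp_bound : weilIncrement wp t ≤ (2 * (a * S₁ + 2 * C * S₀) ^ 2 + 10 * S₀ ^ 2) * t := by
    refine weilIncrement_le_linear_of_small_window (c := a - ε) hε hwpm (fun x hx ↦ ?_) (fun x ↦ ?_)
      (fun x y hx hy ↦ ?_) hL0 hΛ ht
    · simp only [hwp]
      split_ifs with h0
      · rw [mem_Icc, not_and_or, not_le, not_le] at hx
        rcases hx with hx | hx
        · exact hw1 x (by rw [abs_of_nonneg h0]; linarith)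
        · exact hw0 x fun h ↦ by linarith [h.2]
      · rfl
    · simp only [hwp]; split_ifs
      · exact hwb x
      · rw [norm_zero]; exact hS₀0
    · have hx0 : 0 ≤ x := by linarith [hx.1]
      have hy0 : 0 ≤ y := by linarith [hy.1]
      simp only [hwp, if_pos hx0, if_pos hy0]
      exact hwlip x y ⟨by linarith [hx.1], by linarith [hx.2]⟩ ⟨by linarith [hy.1], by linarith [hy.2]⟩
  -- the left piece lives on `[−a, −a + 2ε] = [c − ε, c + ε]`, `c = ε − a`
  have hwm_bound : weilIncrement wm t ≤ (2 * (a * S₁ + 2 * C * S₀) ^ 2 + 10 * S₀ ^ 2) * t := by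
    refine weilIncrement_le_linear_of_small_window (c := ε - a) hε hwmm (fun x hx ↦ ?_) (fun x ↦ ?_)
      (fun x y hx hy ↦ ?_) hL0 hΛ ht
    · simp only [hwm]
      split_ifs with h0
      · rfl
      · rw [mem_Icc, not_and_or, not_le, not_le] at hx
        rcases hx with hx | hx
        · exact hw0 x fun h ↦ by linarith [h.1]
        · exact hw1 x (by rw [abs_of_neg (lt_of_not_ge h0)]; linarith)
    · simp only [hwm]; split_ifs
      · rw [norm_zero]; exact hS₀0
      · exact hwb x
    · by_cases hx0 : 0 ≤ x
      · have hxw : wm x = 0 := by simp only [hwm, if_pos hx0]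
        have : w x = 0 := hw1 x (by rw [abs_of_nonneg hx0]; linarith [hx.2])
        by_cases hy0 : 0 ≤ y
        · have hyw : wm y = 0 := by simp only [hwm, if_pos hy0]
          rw [hxw, hyw, sub_zero, norm_zero]; positivity
        · have hyw : wm y = w y := by simp only [hwm, if_neg hy0]
          rw [hxw, hyw, ← this]
          exact hwlip x y ⟨by linarith [hx.1], by linarith [hx.2]⟩ ⟨by linarith [hy.1], by linarith [hy.2]⟩
      · have hxw : wm x = w x := by simp only [hwm, if_neg hx0]
        by_cases hy0 : 0 ≤ y
        · have hyw : wm y = 0 := by simp only [hwm, if_pos hy0]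
          have : w y = 0 := hw1 y (by rw [abs_of_nonneg hy0]; linarith [hy.2])
          rw [hxw, hyw, ← this]
          exact hwlip x y ⟨by linarith [hx.1], by linarith [hx.2]⟩ ⟨by linarith [hy.1], by linarith [hy.2]⟩
        · have hyw : wm y = w y := by simp only [hwm, if_neg hy0]
          rw [hxw, hyw]
          exact hwlip x y ⟨by linarith [hx.1], by linarith [hx.2]⟩ ⟨by linarith [hy.1], by linarith [hy.2]⟩
  -- integrability of all increments (window functions on `[−a, a]`)
  have hwpz : ∀ x, x ∉ Icc (-a) a → wp x = 0 := fun x hx ↦ by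
    simp only [hwp]; split_ifs
    · exact hw0 x hx
    · rfl
  have hwmz : ∀ x, x ∉ Icc (-a) a → wm x = 0 := fun x hx ↦ by
    simp only [hwm]; split_ifs
    · rfl
    · exact hw0 x hx
  have hwpb : ∀ x, ‖wp x‖ ≤ S₀ := fun x ↦ by
    simp only [hwp]; split_ifs
    · exact hwb x
    · rw [norm_zero]; exact hS₀0
  have hwmb : ∀ x, ‖wm x‖ ≤ S₀ := fun x ↦ by
    simp only [hwm]; split_ifs
    · rw [norm_zero]; exact hS₀0
    · exact hwb x
  have hDu := weilIncrement_le_window_linear ha.le hum huz hS₀ hS₁ ht.le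
  have hDw : weilIncrement w t ≤ 2 * weilIncrement wp t + 2 * weilIncrement wm t := by
    rw [hwsplit]
    exact weilIncrement_add_le t (integrable_norm_sub_sq_window hwpm hwpz hwpb t)
      (integrable_norm_sub_sq_window hwmm hwmz hwmb t)
  have hDg : weilIncrement (u + w) t ≤ 2 * weilIncrement u t + 2 * weilIncrement w t :=
    weilIncrement_add_le t (integrable_norm_sub_sq_window hum huz hS₀ t)
      (integrable_norm_sub_sq_window hwm_meas hw0 hwb t)
  rw [hg]
  linarith [hDg, hDw, hDu, hwp_bound, hwm_bound]

end Summit.RiemannHypothesis.RiemannHypothesis.Theorems.WeilFormatC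

end
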